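import Mathlib.Analysis.Complex.ExponentialBounds
import Mathlib.Analysis.SpecialFunctions.Log.Basic
import Mathlib.Tactic
import Literature.NumberTheory.Irrationality.BrownZudilin2022.TotallySymmetric
import Literature.NumberTheory.Transcendental.ZetaLinearFormsCriterion
import HarnessLib

/-!
# ζ(5) search — the exact margin of the totally symmetric cellular family

HONEST FRAMING: systematic search; no irrationality claim unless certified.

Cell `pub-zeta5` (summit KontsevichZagierPeriods, topic Zeta5Search), seat P1. For the totally symmetric
Brown–Zudilin family (`Literature.NumberTheory.Irrationality.BrownZudilin2022.TotallySymmetric`: forms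
`I'_n = Q_n ζ(5) - P_n`, denominators of type `d_n⁵ = lcm(1,…,n)⁵`), this file turns the PUBLISHED rate
(named fact `BrownZudilin2022.rates`: `log|I'_n|/n → log|λ₂|`, `λ₂ = -0.08438431…` the middle root of
`4λ³ - 2368λ² - 188λ + 1`) and the prime number theorem PROVED in the tree
(`Literature.NumberTheory.Transcendental.tendsto_log_lcmUpto_div`: `log d_n / n → 1`) into the cell's
margin statement, with certified decimal enclosures:

* `log_abs_lambda₂` — for any `l` in the proved root bracket `(-0.0843843162, -0.0843843161)`:
  `-2.473 < log|l| < -2.472` (via `e^{-2.473} < 0.0843843161` and `0.0843843162 < e^{-2.472}`, from Mathlib's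
  `exp(-1)` enclosures and `Real.exp_bound`);
* `scaled_forms_rate` — under `rates` and eventual non-vanishing of the forms,
  `log(d_n⁵|I'_n|)/n → r` with `2.527 < r < 2.528` (`r = 5 + log|λ₂| = 2.52762628…`): the integer-normalised forms
  GROW exponentially — a near-miss, margin `c + φ - δ = -r < -2.527 < 0` in the units of `Criteria.lean`;
* `margin_lt` — consequently any decay exponent `c` (`|I'_n| ≤ e^{-cn}` eventually) and any denominator exponent
  `δ` (`d_n⁵ ≤ e^{δn}` eventually) satisfy `c - δ < -2.527`;
* `forms_ne_zero` — the non-vanishing hypothesis follows from Zudilin's Theorem 1 (signs, named fact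
  `Zudilin2002.theorem1_signs`) and `BrownZudilin2022.Q_solvesRec`, through the proved gauge.

Conditional on the named facts as stated; nothing here is a claim about the arithmetic nature of `ζ(5)`.
-/

noncomputable section

namespace Summit.KontsevichZagierPeriods.Zeta5Search.SymmetricFamily

open Filter Finset Set
open scoped Topology
open Literature.NumberTheory.Irrationality
open Literature.NumberTheory.Irrationality.BrownZudilin2022
open Literature.NumberTheory.Transcendental (zetaValue tendsto_log_lcmUpto_div)

/-! ### Certified exponential enclosures -/

/-- `0.6237 < e^{-0.472}` (`0.472 = 59/125`; `e^{-0.472} = 0.6237535…`), from `Real.exp_bound` with 8 terms. -/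
theorem exp_neg_d472_gt : (6237 / 10000 : ℝ) < Real.exp (-(59 / 125)) := by
  have hx : |(-(59 / 125) : ℝ)| ≤ 1 := by rw [abs_le]; constructor <;> norm_num
  have h := Real.exp_bound hx (n := 8) (by norm_num)
  have h' := (abs_sub_le_iff.1 h).2
  simp only [sum_range_succ, sum_range_zero, Nat.factorial] at h'
  norm_num at h'
  linarith

/-- `e^{-0.473} < 0.6232` (`e^{-0.473} = 0.6231300…`), from `Real.exp_bound` with 8 terms. -/
theorem exp_neg_d473_lt : Real.exp (-(473 / 1000)) < (6232 / 10000 : ℝ) := by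
  have hx : |(-(473 / 1000) : ℝ)| ≤ 1 := by rw [abs_le]; constructor <;> norm_num
  have h := Real.exp_bound hx (n := 8) (by norm_num)
  have h' := (abs_sub_le_iff.1 h).1
  simp only [sum_range_succ, sum_range_zero, Nat.factorial] at h'
  norm_num at h'
  linarith

/-- `0.0843843162 < e^{-2.472}` (`2.472 = 309/125`; `e^{-2.472} = 0.0844158…`). -/
theorem exp_neg_d2472_gt : (843843162 / 10 ^ 10 : ℝ) < Real.exp (-(309 / 125)) := by
  have h1 := Real.exp_neg_one_gt_d9
  have h2 := exp_neg_d472_gt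
  have he : Real.exp (-(309 / 125)) = Real.exp (-1) * Real.exp (-1) * Real.exp (-(59 / 125)) := by
    rw [← Real.exp_add, ← Real.exp_add]; norm_num
  rw [he]
  have h0 : (0 : ℝ) < Real.exp (-1) := Real.exp_pos _
  have h3 : (0 : ℝ) < Real.exp (-(59 / 125)) := Real.exp_pos _
  have h4 : (0.36787944116 : ℝ) * 0.36787944116 < Real.exp (-1) * Real.exp (-1) := by nlinarith
  calc (843843162 / 10 ^ 10 : ℝ) < 0.36787944116 * 0.36787944116 * (6237 / 10000) := by norm_num
    _ < Real.exp (-1) * Real.exp (-1) * Real.exp (-(59 / 125)) := by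
        have := mul_lt_mul'' h4 h2 (by norm_num) (by norm_num)
        linarith [this]

/-- `e^{-2.473} < 0.0843843161` (`e^{-2.473} = 0.0843314…`). -/
theorem exp_neg_d2473_lt : Real.exp (-(2473 / 1000)) < (843843161 / 10 ^ 10 : ℝ) := by
  have h1 := Real.exp_neg_one_lt_d9
  have h2 := exp_neg_d473_lt
  have he : Real.exp (-(2473 / 1000)) = Real.exp (-1) * Real.exp (-1) * Real.exp (-(473 / 1000)) := by
    rw [← Real.exp_add, ← Real.exp_add]; norm_num
  rw [he]
  have h0 : (0 : ℝ) < Real.exp (-1) := Real.exp_pos _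
  have h3 : (0 : ℝ) < Real.exp (-(473 / 1000)) := Real.exp_pos _
  have h4 : Real.exp (-1) * Real.exp (-1) < 0.3678794412 * 0.3678794412 := by nlinarith
  calc Real.exp (-1) * Real.exp (-1) * Real.exp (-(473 / 1000))
      < 0.3678794412 * 0.3678794412 * (6232 / 10000) := by
        have := mul_lt_mul'' h4 h2 (by positivity) h3.le
        linarith [this]
    _ < 843843161 / 10 ^ 10 := by norm_num

/-- **Enclosure of `log|λ₂|`.** For every `l` in the proved bracket of the middle characteristic root,
`-2.473 < log|l| < -2.472` (`log|λ₂| = -2.47237372…`). -/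
theorem log_abs_lambda₂ {l : ℝ} (hl : l ∈ Ioo (-843843162 / 10 ^ 10 : ℝ) (-843843161 / 10 ^ 10)) :
    -(2473 / 1000 : ℝ) < Real.log |l| ∧ Real.log |l| < -(2472 / 1000) := by
  obtain ⟨hl1, hl2⟩ := hl
  have habs : |l| = -l := abs_of_neg (by linarith)
  have hpos : 0 < |l| := by rw [habs]; linarith
  constructor
  · rw [Real.lt_log_iff_exp_lt hpos, habs]
    linarith [exp_neg_d2473_lt]
  · rw [Real.log_lt_iff_lt_exp hpos, habs, show (-(2472 / 1000) : ℝ) = -(309 / 125) by norm_num]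
    linarith [exp_neg_d2472_gt]

/-! ### The margin -/

/-- **The scaled forms grow at rate `5 + log|λ₂| ∈ (2.527, 2.528)`.** Under the published rates
(`BrownZudilin2022.rates`) and eventual non-vanishing of the forms (`forms_ne_zero`), with
`d_n = lcm(1,…,n)`: `(1/n) log(d_n⁵ |Q_nζ(5) - P_n|) → r`, `2.527 < r < 2.528`. The limit is
`5 · lim log d_n/n + lim log|I'_n|/n = 5 + log|λ₂|` (prime number theorem, tree-proved). -/
theorem scaled_forms_rate (h : rates)
    (hne : ∀ᶠ n : ℕ in atTop, (Q n : ℝ) * zetaValue 5 - (P n : ℝ) ≠ 0) :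
    ∃ r : ℝ, (2527 / 1000 : ℝ) < r ∧ r < 2528 / 1000 ∧
      Tendsto (fun n : ℕ =>
        Real.log ((Nat.lcmUpto n : ℝ) ^ 5 * |(Q n : ℝ) * zetaValue 5 - (P n : ℝ)|) / n) atTop (𝓝 r) := by
  obtain ⟨l₂, l₃, -, hl₂, -, -, hI', -, -⟩ := h
  obtain ⟨hlo, hhi⟩ := log_abs_lambda₂ hl₂
  refine ⟨5 + Real.log |l₂|, by linarith, by linarith, ?_⟩
  have hsum : Tendsto (fun n : ℕ => 5 * (Real.log (Nat.lcmUpto n) / n)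
      + Real.log |(Q n : ℝ) * zetaValue 5 - (P n : ℝ)| / n) atTop (𝓝 (5 * 1 + Real.log |l₂|)) :=
    (tendsto_log_lcmUpto_div.const_mul 5).add hI'
  rw [show (5 : ℝ) + Real.log |l₂| = 5 * 1 + Real.log |l₂| by ring]
  refine hsum.congr' ?_
  filter_upwards [hne] with n hn
  have hd : (0 : ℝ) < (Nat.lcmUpto n : ℝ) := by exact_mod_cast Nat.lcmUpto_pos n
  have habs : (0 : ℝ) < |(Q n : ℝ) * zetaValue 5 - (P n : ℝ)| := abs_pos.mpr hn
  rw [Real.log_mul (pow_pos hd 5).ne' habs.ne', Real.log_pow]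
  push_cast
  ring

/-- **Margin bound.** Under the same hypotheses: if `|Q_nζ(5) - P_n| ≤ e^{-cn}` for all large `n` (a decay
exponent `c`) and `d_n⁵ ≤ e^{δn}` for all large `n` (a denominator exponent `δ`), then `c - δ < -2.527`.
In the units of the cell's `Criteria.lean` (savings `φ = 0`): the margin `c + φ - δ` of this family is
below `-2.527`; no `LinearFormCertificate` can be assembled from these forms and denominators. -/
theorem margin_lt (h : rates)
    (hne : ∀ᶠ n : ℕ in atTop, (Q n : ℝ) * zetaValue 5 - (P n : ℝ) ≠ 0) {c δ : ℝ}
    (hc : ∀ᶠ n : ℕ in atTop, |(Q n : ℝ) * zetaValue 5 - (P n : ℝ)| ≤ Real.exp (-(c * n)))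
    (hδ : ∀ᶠ n : ℕ in atTop, ((Nat.lcmUpto n : ℝ)) ^ 5 ≤ Real.exp (δ * n)) :
    c - δ < -(2527 / 1000) := by
  obtain ⟨r, hr1, -, hr⟩ := scaled_forms_rate h hne
  -- eventually `log(d_n⁵|I'_n|)/n ≤ δ - c`, so the limit `r` satisfies `r ≤ δ - c`
  have hle : ∀ᶠ n : ℕ in atTop,
      Real.log ((Nat.lcmUpto n : ℝ) ^ 5 * |(Q n : ℝ) * zetaValue 5 - (P n : ℝ)|) / n ≤ δ - c := by
    filter_upwards [hne, hc, hδ, eventually_gt_atTop 0] with n hn hcn hδn hn0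
    have hd : (0 : ℝ) < (Nat.lcmUpto n : ℝ) ^ 5 := pow_pos (by exact_mod_cast Nat.lcmUpto_pos n) 5
    have habs : (0 : ℝ) < |(Q n : ℝ) * zetaValue 5 - (P n : ℝ)| := abs_pos.mpr hn
    have hprod : (Nat.lcmUpto n : ℝ) ^ 5 * |(Q n : ℝ) * zetaValue 5 - (P n : ℝ)|
        ≤ Real.exp (δ * n) * Real.exp (-(c * n)) :=
      mul_le_mul hδn hcn habs.le (Real.exp_pos _).le
    have hlog : Real.log ((Nat.lcmUpto n : ℝ) ^ 5 * |(Q n : ℝ) * zetaValue 5 - (P n : ℝ)|)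
        ≤ (δ - c) * n := by
      have := Real.log_le_log (mul_pos hd habs) hprod
      rw [← Real.exp_add, Real.log_exp] at this
      linarith
    have hn' : (0 : ℝ) < n := by exact_mod_cast hn0
    rw [div_le_iff₀ hn']
    exact hlog
  have hrle : r ≤ δ - c := le_of_tendsto hr hle
  linarith

/-! ### Non-vanishing from Zudilin's Theorem 1 -/

/-- `Q 0 = 1`, `Q 1 = 21`, `Q 2 = 2989` (the printed initial values). -/
theorem Q_init : Q 0 = 1 ∧ Q 1 = 21 ∧ Q 2 = 2989 := by
  refine ⟨?_, ?_, ?_⟩ <;> decide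

/-- Under `Q_solvesRec` (named fact: the binomial sum solves the recursion for all `n`), `Q_n = Qsol_n`
for all `n` (uniqueness of solutions; initial values `1, 21, 2989`). -/
theorem Q_eq_Qsol_of_solvesRec (hq : Q_solvesRec) (n : ℕ) : (Q n : ℚ) = Qsol n := by
  have h := SolvesRec.ext_of_init hq (recSol_solvesRec 1 21 2989)
    (by simp [Q_init.1]) (by simp [Q_init.2.1]) (by simp [Q_init.2.2])
  exact congrFun h n

/-- **Non-vanishing of the forms.** Under Zudilin's Theorem 1 (signs: `ℓ_n = q_nζ(5) - p_n > 0`, named fact)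
and `Q_solvesRec`, `Q_nζ(5) - P_n ≠ 0` for every `n ≥ 1`, since `ℓ_n = (-1)^{n+1} binom(2n,n)(Q_nζ(5) - P_n)`
by the proved gauge. -/
theorem forms_ne_zero (hs : Zudilin2002.theorem1_signs) (hq : Q_solvesRec) {n : ℕ} (hn : 1 ≤ n) :
    (Q n : ℝ) * zetaValue 5 - (P n : ℝ) ≠ 0 := by
  intro h0
  have hpos := (hs n hn).1
  unfold Zudilin2002.ell at hpos
  rw [congrFun q_eq_gauge n, congrFun p_eq_gauge n] at hpos
  unfold BrownZudilin2022.gauge at hpos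
  rw [← Q_eq_Qsol_of_solvesRec hq n] at hpos
  push_cast at hpos
  have : ((-1 : ℝ) ^ (n + 1) * (Nat.centralBinom n : ℝ)) * ((Q n : ℝ) * zetaValue 5 - (P n : ℝ)) = 0 := by
    rw [h0, mul_zero]
  nlinarith [this]

/-- The eventual form of `forms_ne_zero`, as consumed by `scaled_forms_rate` / `margin_lt`. -/
theorem forms_eventually_ne_zero (hs : Zudilin2002.theorem1_signs) (hq : Q_solvesRec) :
    ∀ᶠ n : ℕ in atTop, (Q n : ℝ) * zetaValue 5 - (P n : ℝ) ≠ 0 := by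
  filter_upwards [eventually_ge_atTop 1] with n hn
  exact forms_ne_zero hs hq hn

end Summit.KontsevichZagierPeriods.Zeta5Search.SymmetricFamily
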